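import Summits.CriticalPhenomena.Ising3DConformalLimit.Theorems.HyperoctahedralRPExistsScaleCovariantLimitFoldedCurrentIdentity
import Literature.Probability.LatticeModels.CriticalTwoPointDCPLowerLemma25
import HarnessLib

/-!
# Stub `stub_foldUnion` — exit through a face is a folded connection; union bound + fold identity
# (crux `ExistsContinuousLimit`, stmt-CriticalPhenomena-4582, line `free-box-deficit`, lead c5)

Registered stub 3 of the checked skeleton of line `free-box-deficit` of the crux
`Summit.CriticalPhenomena.Ising3DConformalLimit.Theses.ReflectionTwin.ExistsContinuousLimit`.

**Statement.** Let `(θ_j, H_j)_{j ∈ ι}` be a finite family of fold data on `(G, Λ)` (`IsFoldable G (θ j) Λ (H j)`)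
whose strict halves all contain a vertex set `T` (`T ⊆ H j`), and such that every edge `{v, w}` of `G` leaving `T`
(`v ∈ T`, `w ∉ T`) ends on a `θ_j`-fixed vertex `w` for some `j` (the face mirrors of a box catch every exit
edge). Then for `x, y ∈ T` and `β ≥ 0`,

  `Z_{ℰ_Λ}({x} ∆ {y}) ≤ Z^{xy}_{ℰ_Λ}[C_n(y) ⊆ T] + ∑_j Z_{ℰ_Λ}({x} ∆ {θ_j y})`.

**Proof.** *Pointwise*: for a current `n` either the `n`-cluster of `y` stays inside `T`, or there is a charged
path from `y` to some `v ∉ T`; its first exit edge `{x', w}` (`x' ∈ T`, `w ∈ Λ ∖ T`, `G.Adj x' w`, charged,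
with the prefix path inside `ℰ_T`; `exists_exit_edge`) ends on a `θ_j`-fixed vertex `w` (`hexit`). Every prefix
edge and the exit edge have an endpoint in `T ⊆ H_j`, hence are left edges of the datum `j`, on which
`fold_j n ≥ n > 0`; so `y` is joined to the fixed vertex `w ∈ Λ` in the folded current, i.e.
`ConnFix_j (fold_j n) y`. Hence
`𝟙[src ∧ supp] ≤ 𝟙[src ∧ supp ∧ C_n(y) ⊆ T] + ∑_j 𝟙[src ∧ supp] 𝟙[ConnFix_j (fold_j n) y]`.
*Sum*: multiply by `w_β(n)`, sum over `n`, swap the finite `j`-sum with the `n`-sum, and recognise each `j`-term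
as `Z_{ℰ_Λ}({x} ∆ {θ_j y})` by the folded switching identity `currentZ_singleton_symmDiff_reflect_eq`
(Aizenman 2025, Thm 14.2 / Lemma 14.3; Duminil-Copin–Panis 2025, Lemma 2.3).
-/

noncomputable section

namespace Summit.CriticalPhenomena.Ising3DConformalLimit.ReflectionTwinExistsContinuousLimit.FreeBox

open Finset Filter
open scoped BigOperators symmDiff ENNReal Topology
open Literature.Probability.LatticeModels
open Summit.CriticalPhenomena.Ising3DConformalLimit.Cruxes.ExistsScaleCovariantLimit.FoldedCurrentRepulsion
  (currentZ_singleton_symmDiff_reflect_eq)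
open Classical

section Pointwise

variable {V : Type*} [DecidableEq V] {G : SimpleGraph V} [G.LocallyFinite] {Λ : Finset V}

/-- A connection through `n`-charged edges of `ℰ_T`, `T ⊆ H₋`, is a connection in the folded current `fold n`
through edges of `ℰ_Λ` (every edge of `ℰ_T` is a left edge, and `fold n ≥ n` on left edges). [folklore] -/
theorem cconn_fold_of_cconn_edgesIn {θ : V ≃ V} {Hm : Finset V} (h : IsFoldable G θ Λ Hm) {T : Finset V}
    (hT : T ⊆ Hm) {n : edgesIn G Λ → ℕ} {u v : V} (hc : CConn G Λ n (edgesIn G T) u v) :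
    CConn G Λ (h.fold n) (edgesIn G Λ) u v := by
  induction hc with
  | refl => exact Relation.ReflTransGen.refl
  | @tail b c _ hbc ih =>
    obtain ⟨e, heT, hpos, hes⟩ := hbc
    refine ih.tail ⟨e, e.2, ?_, hes⟩
    have hbe : b ∈ (e : Sym2 V) := hes ▸ Sym2.mem_mk_left b c
    have hl : IsLeft Hm (e : Sym2 V) := ⟨b, hT ((mem_edgesIn_iff.1 heT).2 b hbe), hbe⟩
    exact h.fold_pos_iff'.2 ⟨hl, Or.inl hpos⟩

/-- **Exit through a face is a folded connection.** If the strict halves `H_j` of the fold data all contain `T`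
and every edge leaving `T` ends on a `θ_j`-fixed vertex for some `j`, then a charged path from `y ∈ T` to a vertex
`v ∉ T` makes `y` connected to the hyperplane of some datum `j` in its folded current: the first exit edge
`{x', w}` of the path ends on a fixed vertex `w ∈ Λ` of some `θ_j`, and the prefix (inside `ℰ_T`) together with
the exit edge consists of left edges of the datum `j`, on which `fold_j n ≥ n > 0`. [folklore] -/
theorem exists_connFix_fold_of_cconn {ι : Type*} (θ : ι → V ≃ V) (H : ι → Finset V)
    (hfold : ∀ j, IsFoldable G (θ j) Λ (H j)) {T : Finset V} (hTH : ∀ j, T ⊆ H j)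
    (hexit : ∀ v w, v ∈ T → w ∉ T → G.Adj v w → ∃ j, θ j w = w) {n : edgesIn G Λ → ℕ} {y v : V}
    (hy : y ∈ T) (hv : v ∉ T) (hc : CConn G Λ n (edgesIn G Λ) y v) :
    ∃ j, (hfold j).ConnFix ((hfold j).fold n) y := by
  obtain ⟨x', hx'T, w, hw, hadj, ⟨e, hes, hpos⟩, hpre⟩ := exists_exit_edge hc hy hv
  obtain ⟨hwΛ, hwT⟩ := mem_sdiff.1 hw
  obtain ⟨j, hj⟩ := hexit x' w hx'T hwT hadj
  refine ⟨j, w, hwΛ, hj, (cconn_fold_of_cconn_edgesIn (hfold j) (hTH j) hpre).tail ⟨e, e.2, ?_, hes⟩⟩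
  exact (hfold j).fold_pos_iff'.2 ⟨⟨x', hTH j hx'T, hes ▸ Sym2.mem_mk_left x' w⟩, Or.inl hpos⟩

/-- **Pointwise union bound.** For every current `n`,
`𝟙[∂n = {x}∆{y} ∧ supp] w(n) ≤ 𝟙[∂n = {x}∆{y} ∧ supp ∧ C_n(y) ⊆ T] w(n) + ∑_j 𝟙[∂n = {x}∆{y} ∧ supp] w(n) 𝟙[y ⟷ Fix θ_j in fold_j n]`:
either the cluster of `y` stays in `T`, or `exists_connFix_fold_of_cconn` produces a datum `j` whose indicator is `1`.
[folklore] -/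
theorem ind_mul_cweight_le_add_sum {ι : Type*} [Fintype ι] (θ : ι → V ≃ V) (H : ι → Finset V)
    (hfold : ∀ j, IsFoldable G (θ j) Λ (H j)) {T : Finset V} (hTH : ∀ j, T ⊆ H j)
    (hexit : ∀ v w, v ∈ T → w ∉ T → G.Adj v w → ∃ j, θ j w = w) (β : ℝ) (A : Finset V) {y : V} (hy : y ∈ T)
    (n : edgesIn G Λ → ℕ) :
    ind (csources G Λ n = A ∧ CSupp G Λ (edgesIn G Λ) n) * cweight G Λ β n ≤
      ind (csources G Λ n = A ∧ CSupp G Λ (edgesIn G Λ) n ∧ ∀ v, CConn G Λ n (edgesIn G Λ) y v → v ∈ T) *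
          cweight G Λ β n +
        ∑ j, ind (csources G Λ n = A ∧ CSupp G Λ (edgesIn G Λ) n) * cweight G Λ β n *
          ind ((hfold j).ConnFix ((hfold j).fold n) y) := by
  by_cases hQ : ∀ v, CConn G Λ n (edgesIn G Λ) y v → v ∈ T
  · have hPQ : ind (csources G Λ n = A ∧ CSupp G Λ (edgesIn G Λ) n ∧
          ∀ v, CConn G Λ n (edgesIn G Λ) y v → v ∈ T) =
        ind (csources G Λ n = A ∧ CSupp G Λ (edgesIn G Λ) n) :=
      ind_congr ⟨fun h => ⟨h.1, h.2.1⟩, fun h => ⟨h.1, h.2, hQ⟩⟩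
    rw [hPQ]
    exact le_self_add
  · push Not at hQ
    obtain ⟨v, hc, hv⟩ := hQ
    obtain ⟨j, hj⟩ := exists_connFix_fold_of_cconn θ H hfold hTH hexit hy hv hc
    refine le_add_left ?_
    calc ind (csources G Λ n = A ∧ CSupp G Λ (edgesIn G Λ) n) * cweight G Λ β n
        = ind (csources G Λ n = A ∧ CSupp G Λ (edgesIn G Λ) n) * cweight G Λ β n *
            ind ((hfold j).ConnFix ((hfold j).fold n) y) := by rw [ind_of_true hj, mul_one]
      _ ≤ ∑ j, ind (csources G Λ n = A ∧ CSupp G Λ (edgesIn G Λ) n) * cweight G Λ β n *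
            ind ((hfold j).ConnFix ((hfold j).fold n) y) :=
        Finset.single_le_sum (f := fun j => ind (csources G Λ n = A ∧ CSupp G Λ (edgesIn G Λ) n) *
            cweight G Λ β n * ind ((hfold j).ConnFix ((hfold j).fold n) y)) (fun _ _ => zero_le)
          (mem_univ j)

end Pointwise

/-- **Stub 3 — exit through a face is a folded connection; union bound + fold identity.** For fold data
`(θ_j, H_j)_j` on `(G, Λ)` whose strict halves all contain `T` and such that every edge leaving `T` ends on a
`θ_j`-fixed vertex for some `j`: `Z^{xy}_{ℰ_Λ} ≤ Z^{xy}_{ℰ_Λ}[C_n(y) ⊆ T] + ∑_j Z_{ℰ_Λ}({x} ∆ {θ_j y})`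
(pointwise union bound `ind_mul_cweight_le_add_sum`, summed over currents, the `j`-terms recognised by the folded
switching identity `currentZ_singleton_symmDiff_reflect_eq`).
[cite: DuminilCopinPanis2025LowerBounds, Lemma 2.3] -/
theorem stub_foldUnion {V : Type*} [DecidableEq V] (G : SimpleGraph V) [G.LocallyFinite] (Λ : Finset V)
    {β : ℝ} (hβ : 0 ≤ β) {ι : Type*} [Fintype ι] (θ : ι → V ≃ V) (H : ι → Finset V)
    (hfold : ∀ j, IsFoldable G (θ j) Λ (H j)) (T : Finset V) (hTH : ∀ j, T ⊆ H j)
    (hexit : ∀ v w, v ∈ T → w ∉ T → G.Adj v w → ∃ j, θ j w = w) (x y : V) (hx : x ∈ T) (hy : y ∈ T) :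
    currentZ G Λ β (edgesIn G Λ) ({x} ∆ {y}) ≤
      (∑' n : edgesIn G Λ → ℕ,
        ind (csources G Λ n = {x} ∆ {y} ∧ CSupp G Λ (edgesIn G Λ) n ∧ ∀ v, CConn G Λ n (edgesIn G Λ) y v → v ∈ T) *
          cweight G Λ β n) +
      ∑ j, currentZ G Λ β (edgesIn G Λ) ({x} ∆ {θ j y}) := by
  have hj : ∀ j, currentZ G Λ β (edgesIn G Λ) ({x} ∆ {θ j y}) =
      ∑' n : edgesIn G Λ → ℕ, ind (csources G Λ n = {x} ∆ {y} ∧ CSupp G Λ (edgesIn G Λ) n) * cweight G Λ β n *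
        ind ((hfold j).ConnFix ((hfold j).fold n) y) :=
    fun j => currentZ_singleton_symmDiff_reflect_eq (hfold j) hβ (hTH j hx) (hTH j hy)
  rw [Finset.sum_congr rfl fun j _ => hj j, ← Summable.tsum_finsetSum (fun _ _ => ENNReal.summable),
    ← ENNReal.tsum_add]
  unfold currentZ
  exact ENNReal.tsum_le_tsum fun n => ind_mul_cweight_le_add_sum θ H hfold hTH hexit β ({x} ∆ {y}) hy n

end Summit.CriticalPhenomena.Ising3DConformalLimit.ReflectionTwinExistsContinuousLimit.FreeBox

end
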